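import Mathlib
import HarnessLib
import Summits.Ventures.LatticeQCDFlow.Scoring.GaussianWelchScaleMixture

/-!
# THE UNEQUAL-COUNT TWO-ARM (WELCH-TYPE) BOUNDARY IS GAUSSIAN-NULL:
# `(N^{⊗a} ⊗ N^{⊗b}){(αḡ − βh̄)² = t²(α²s²(g)/a + β²s²(h)/b)} = 0`

HONEST FRAMING: exact (Metropolis-corrected) sampling algorithms for lattice gauge theory;
figures of merit are autocorrelation/cost numbers at stated couplings and volumes; no
continuum-physics claim.

Venture `LatticeQCDFlow` (cell pub-lqcd), topic `Scoring`; FANOUT row 4 (`s0-u1-b`, GEN-33).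
NEW WORK of the cell (classical), no definition, nothing cited as a fact.

WHY (row 4).  A chain-level fixed-batch-count theorem for two runs with UNEQUAL numbers of batches
(GEN-32's open item "unequal arms … needs a boundary lemma with two different k's") converges, by
the portmanteau theorem, on events whose boundary is null for the Gaussian limit.  For the
Welch-type limit event `{(αḡ − βh̄)² ≤ t²(α²s²(g)/a + β²s²(h)/b)}` the boundary is contained in the
level set `{(αḡ − βh̄)² = t²(…)}`; this file proves that level set is `N^{⊗a} ⊗ N^{⊗b}`-null for
every `t`, all weights with `α²/a + β²/b > 0` and all `a = n + 1`, `b = m + 1` — in thirty lines from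
the joint law of `Scoring/GaussianWelchScaleMixture` (after Helmert on each arm the numerator is ONE
standard normal coordinate `U`, independent of the tails; conditionally on the tails the level set
is `{|U| = c}`, two points, and `N(0,1)` has no atoms), instead of the coordinate-geometric argument
of GEN-32's equal-count `GaussianStudentBoundary`.

## Content

* **`pi_gaussianReal_welch_levelSet_eq_zero`** — the level set is null (any `t`, `n`, `m`).

Depends on `Scoring/GaussianWelchScaleMixture` and `Scoring/GaussianStudentEventReduction`
(row 4 GEN-33).  [ours] throughout.
-/

open MeasureTheory ProbabilityTheory Filter Topology Finset

namespace Summit.Ventures.LatticeQCDFlow.Scoring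

open Set WithLp

section Boundary

/-- **The Welch-type level set is Gaussian-null**: for every `t`, `a = n + 1`, `b = m + 1` and
weights with `α²/a + β²/b > 0`,
`(N^{⊗a} ⊗ N^{⊗b}){(g,h) | (αḡ − βh̄)² = t²(α²s²(g)/a + β²s²(h)/b)} = 0`. [ours] -/
theorem pi_gaussianReal_welch_levelSet_eq_zero (t : ℝ) (n m : ℕ) {α β : ℝ}
    (hτ : 0 < α ^ 2 / ((n + 1 : ℕ) : ℝ) + β ^ 2 / ((m + 1 : ℕ) : ℝ)) :
    ((Measure.pi fun _ : Fin (n + 1) => gaussianReal 0 1).prod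
        (Measure.pi fun _ : Fin (m + 1) => gaussianReal 0 1))
      {p : (Fin (n + 1) → ℝ) × (Fin (m + 1) → ℝ) |
        (α * ((∑ i, p.1 i) / ((n + 1 : ℕ) : ℝ)) - β * ((∑ i, p.2 i) / ((m + 1 : ℕ) : ℝ))) ^ 2
          = t ^ 2 * (α ^ 2 * (((∑ j, (p.1 j - (∑ i, p.1 i) / ((n + 1 : ℕ) : ℝ)) ^ 2)
                / (((n + 1 : ℕ) : ℝ) - 1)) / ((n + 1 : ℕ) : ℝ))
            + β ^ 2 * (((∑ j, (p.2 j - (∑ i, p.2 i) / ((m + 1 : ℕ) : ℝ)) ^ 2)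
                / (((m + 1 : ℕ) : ℝ) - 1)) / ((m + 1 : ℕ) : ℝ)))} = 0 := by
  set γ : Measure ℝ := gaussianReal 0 1 with hγ
  set a : ℝ := ((n + 1 : ℕ) : ℝ) with ha'
  set b : ℝ := ((m + 1 : ℕ) : ℝ) with hb'
  have ha : 0 < a := by rw [ha']; positivity
  have hb : 0 < b := by rw [hb']; positivity
  set τ2 : ℝ := α ^ 2 / a + β ^ 2 / b with hτ2
  set la : ℝ := (α ^ 2 / a) / τ2 with hla
  set lb : ℝ := (β ^ 2 / b) / τ2 with hlb
  set πa := Measure.pi fun _ : Fin (n + 1) => γ with hπa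
  set πb := Measure.pi fun _ : Fin (m + 1) => γ with hπb
  -- Helmert on each arm
  set Oa := ((ℝ ∙ ((toLp 2 (fun _ : Fin (n + 1) => (Real.sqrt (Fintype.card (Fin (n + 1))))⁻¹)
      : EuclideanSpace ℝ (Fin (n + 1))) - EuclideanSpace.single 0 (1 : ℝ)))ᗮ).reflection with hOa
  set Ob := ((ℝ ∙ ((toLp 2 (fun _ : Fin (m + 1) => (Real.sqrt (Fintype.card (Fin (m + 1))))⁻¹)
      : EuclideanSpace ℝ (Fin (m + 1))) - EuclideanSpace.single 0 (1 : ℝ)))ᗮ).reflection with hOb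
  set Ψa : (Fin (n + 1) → ℝ) → (Fin (n + 1) → ℝ) := fun z => ofLp (Oa (toLp 2 z)) with hΨa
  set Ψb : (Fin (m + 1) → ℝ) → (Fin (m + 1) → ℝ) := fun z => ofLp (Ob (toLp 2 z)) with hΨb
  have hΨa_mp : MeasurePreserving Ψa πa πa := by
    have := measurePreserving_helmert_pi (ι := Fin (n + 1)) 0
    rwa [← hOa] at this
  have hΨb_mp : MeasurePreserving Ψb πb πb := by
    have := measurePreserving_helmert_pi (ι := Fin (m + 1)) 0
    rwa [← hOb] at this
  obtain ⟨hheadA, htailA⟩ := helmert_head_tail n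
  obtain ⟨hheadB, htailB⟩ := helmert_head_tail m
  rw [← hOa] at hheadA htailA
  rw [← hOb] at hheadB htailB
  have ha1 : a - 1 = (n : ℝ) := by rw [ha']; push_cast; ring
  have hb1 : b - 1 = (m : ℝ) := by rw [hb']; push_cast; ring
  -- Step 1: preimage under `Ψa × Ψb` of the head/tails level set
  set E' : Set ((Fin (n + 1) → ℝ) × (Fin (m + 1) → ℝ)) := {p |
    ((α * p.1 0 / Real.sqrt a - β * p.2 0 / Real.sqrt b) / Real.sqrt τ2) ^ 2
      = t ^ 2 * (la * ((∑ j : Fin n, p.1 j.succ ^ 2) / (n : ℝ))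
        + lb * ((∑ j : Fin m, p.2 j.succ ^ 2) / (m : ℝ)))} with hE'
  have hE'm : MeasurableSet E' := measurableSet_eq_fun (by fun_prop) (by fun_prop)
  have hpre : {p : (Fin (n + 1) → ℝ) × (Fin (m + 1) → ℝ) |
        (α * ((∑ i, p.1 i) / a) - β * ((∑ i, p.2 i) / b)) ^ 2
          = t ^ 2 * (α ^ 2 * (((∑ j, (p.1 j - (∑ i, p.1 i) / a) ^ 2) / (a - 1)) / a)
            + β ^ 2 * (((∑ j, (p.2 j - (∑ i, p.2 i) / b) ^ 2) / (b - 1)) / b))}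
      = (Prod.map Ψa Ψb) ⁻¹' E' := by
    ext p
    simp only [Set.mem_setOf_eq, Set.mem_preimage, hE', Prod.map_fst, Prod.map_snd]
    rw [show Ψa p.1 0 = _ from hheadA p.1, show Ψb p.2 0 = _ from hheadB p.2,
      show ∑ j : Fin n, Ψa p.1 j.succ ^ 2 = _ from htailA p.1,
      show ∑ j : Fin m, Ψb p.2 j.succ ^ 2 = _ from htailB p.2, ha1, hb1]
    set Sg := ∑ i, p.1 i
    set Sh := ∑ i, p.2 i
    set Rg := ∑ j, (p.1 j - Sg / a) ^ 2
    set Rh := ∑ j, (p.2 j - Sh / b) ^ 2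
    have hsa : Real.sqrt a ≠ 0 := (Real.sqrt_pos.2 ha).ne'
    have hsb : Real.sqrt b ≠ 0 := (Real.sqrt_pos.2 hb).ne'
    have e1 : α * (Sg / Real.sqrt a) / Real.sqrt a = α * (Sg / a) := by
      rw [mul_div_assoc, div_div, Real.mul_self_sqrt ha.le]
    have e2 : β * (Sh / Real.sqrt b) / Real.sqrt b = β * (Sh / b) := by
      rw [mul_div_assoc, div_div, Real.mul_self_sqrt hb.le]
    rw [e1, e2, div_pow, Real.sq_sqrt hτ.le]
    set X := Rg / (n : ℝ)
    set Y := Rh / (m : ℝ)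
    have key2 : t ^ 2 * (la * X + lb * Y) = (t ^ 2 * (α ^ 2 * (X / a) + β ^ 2 * (Y / b))) / τ2 := by
      simp only [hla, hlb]
      field_simp
    rw [key2, div_left_inj' hτ.ne']
  rw [show {p : (Fin (n + 1) → ℝ) × (Fin (m + 1) → ℝ) |
        (α * ((∑ i, p.1 i) / ((n + 1 : ℕ) : ℝ)) - β * ((∑ i, p.2 i) / ((m + 1 : ℕ) : ℝ))) ^ 2
          = t ^ 2 * (α ^ 2 * (((∑ j, (p.1 j - (∑ i, p.1 i) / ((n + 1 : ℕ) : ℝ)) ^ 2)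
                / (((n + 1 : ℕ) : ℝ) - 1)) / ((n + 1 : ℕ) : ℝ))
            + β ^ 2 * (((∑ j, (p.2 j - (∑ i, p.2 i) / ((m + 1 : ℕ) : ℝ)) ^ 2)
                / (((m + 1 : ℕ) : ℝ) - 1)) / ((m + 1 : ℕ) : ℝ)))} = (Prod.map Ψa Ψb) ⁻¹' E' from hpre,
    ← Measure.map_apply (hΨa_mp.measurable.prodMap hΨb_mp.measurable) hE'm,
    (hΨa_mp.prod hΨb_mp).map_eq]
  -- Step 2: ONE product Gaussian; the pulled-back level set is `(U, V) ⁻¹' B`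
  set π' := Measure.pi fun _ : Fin (n + 1) ⊕ Fin (m + 1) => γ with hπ'
  have hσ : MeasurePreserving (MeasurableEquiv.sumPiEquivProdPi fun _ : Fin (n + 1) ⊕ Fin (m + 1) => ℝ)
      π' (πa.prod πb) := measurePreserving_sumPiEquivProdPi fun _ : Fin (n + 1) ⊕ Fin (m + 1) => γ
  rw [← hσ.map_eq, Measure.map_apply (MeasurableEquiv.measurable _) hE'm]
  set UV : (Fin (n + 1) ⊕ Fin (m + 1) → ℝ) → ℝ × (Fin n ⊕ Fin m → ℝ) := fun x =>
    ((α * x (Sum.inl 0) / Real.sqrt a - β * x (Sum.inr 0) / Real.sqrt b) / Real.sqrt τ2,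
      fun s : Fin n ⊕ Fin m => x (Sum.map Fin.succ Fin.succ s)) with hUV
  set M : (Fin n ⊕ Fin m → ℝ) → ℝ := fun v =>
    la * ((∑ j : Fin n, v (Sum.inl j) ^ 2) / (n : ℝ)) + lb * ((∑ j : Fin m, v (Sum.inr j) ^ 2) / (m : ℝ))
    with hM
  have hMm : Measurable M := by simp only [hM]; fun_prop
  set B : Set (ℝ × (Fin n ⊕ Fin m → ℝ)) := {q | q.1 ^ 2 = t ^ 2 * M q.2} with hB
  have hBm : MeasurableSet B :=
    measurableSet_eq_fun (by fun_prop) (measurable_const.mul (hMm.comp measurable_snd))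
  have hUVm : Measurable UV := by fun_prop
  have hpre2 : (MeasurableEquiv.sumPiEquivProdPi fun _ : Fin (n + 1) ⊕ Fin (m + 1) => ℝ) ⁻¹' E'
      = UV ⁻¹' B := by
    ext x
    simp only [hE', hB, hUV, hM, Set.mem_preimage, Set.mem_setOf_eq,
      MeasurableEquiv.coe_sumPiEquivProdPi, Equiv.sumPiEquivProdPi, Equiv.coe_fn_mk, Sum.map_inl,
      Sum.map_inr]
  rw [hpre2, ← Measure.map_apply hUVm hBm, hUV, pi_sum_gaussianReal_map_welchHead_tails n m hτ,
    Measure.prod_apply_symm hBm]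
  -- Step 3: every section `{u | u² = c}` has at most two points, hence is `N(0,1)`-null
  haveI : NullSingletonClass (gaussianReal (0 : ℝ) 1) := nullSingletonClass_gaussianReal one_ne_zero
  have hsec : ∀ v : Fin n ⊕ Fin m → ℝ, γ ((fun u : ℝ => (u, v)) ⁻¹' B) = 0 := fun v => by
    have hsub : (fun u : ℝ => (u, v)) ⁻¹' B
        ⊆ {Real.sqrt (t ^ 2 * M v), -Real.sqrt (t ^ 2 * M v)} := by
      intro u hu
      simp only [hB, Set.mem_preimage, Set.mem_setOf_eq] at hu
      have h' : Real.sqrt (u ^ 2) = Real.sqrt (t ^ 2 * M v) := by rw [hu]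
      rw [Real.sqrt_sq_eq_abs] at h'
      rcases abs_eq_abs.1 (show |u| = |Real.sqrt (t ^ 2 * M v)| by
        rw [h', abs_of_nonneg (Real.sqrt_nonneg _)]) with h1 | h1
      · exact Or.inl h1
      · exact Or.inr h1
    exact measure_mono_null hsub ((Set.toFinite _).measure_zero γ)
  refine (lintegral_congr fun v => ?_).trans lintegral_zero
  exact hsec v

end Boundary

end Summit.Ventures.LatticeQCDFlow.Scoring
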